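import Summits.CriticalPhenomena.PercolationContinuityZ3.Theorems.PercNearOneGluingAdditiveGluingSetObserverUnfoldWorld
import HarnessLib

/-!
# Conjecture G / SET-W via a SET observer, XIV: the world term of ONE decoy with a set-observer slot
# (Markov at `C_Y` with a liveness factor, dead decoys drop out, vertex slots exact, the set slot by the DEFECT LEMMA)

Support file (`--supports stmt-CriticalPhenomena-4576`); no definitions, no named facts, no sorries.  Seat (b) V⁺-form `png-dp-vplus`, gen 13
(memo MEMO-gen12.md §4(b),(c), §10 (U)).  Set-slot version of `CSH.decoy_world_term` (`…NoHeavyLowerTailCSHUnfoldDecoy.lean`):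
* `decoy_world_term_set_merge` — steps 1–3 (Markov merge at `C_Y` with the world-dependent liveness factor, alive/dead decoys, the dead part
  dies against the residual): `Σ_ω w 1{x↮Y} Cov_world(g(C_x), ε(d)·sl_{L'}[chiO_d − c](s)) = Σ_ζ w Θ 1_E sl_{L'}[s' ↦ 1_{slotEv s'} − c s'](s)`;
* **`decoy_world_term_set_le`** — for every slot `s ≠ some d`: `… ≤ −m₀⁻¹·sl_{L'}[s' ↦ m₀P₁(s') − m₁(s')P₀](s)` (linearity over the slots; the
  set slot has coefficient `δ_none(s) ≥ 0` and obeys the defect inequality, the vertex slots are exact);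
* **`decoy_world_term_set_some`** — equality at a vertex slot (which never reads the set slot), verbatim the point identity.
[cite: VandenbergHaggstromKahn2005, §2.1 Lemma 2.4 (p. 10); §1 display (10) (pp. 7–8) — corollaries] [cite: KozmaNitzan2024, Conj. 4 (p. 32)]
-/

noncomputable section

namespace Summit.CriticalPhenomena.PercolationContinuityZ3.Theorems

open MeasureTheory Set Literature.Probability.LatticeModels Literature.Probability.Percolation
open scoped Classical

namespace CSHSet

open CSH HullPort BHK2006 DecisionTree

variable {V : Type*} [Fintype V]

/-! ### The world term of one decoy, set-observer slot -/

/-- **The world term of one decoy with a set observer, merged at `C_Y`** (steps 1–3 of `CSH.decoy_world_term`): Markov merge at `C_Y`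
(world-dependent liveness factor), alive decoys have global indicators, dead decoys drop out against the residual:
`Σ_ω w 1{x↮Y} Cov_{world(ω)}(g(C_x), ε(d)·sl_{L'}[chiO_d − c](s)) = Σ_ζ w Θ(ζ)·1_E(ζ)·sl_{L'}[s' ↦ 1_{slotEv O d (S∪Y) s'}(ζ) − c s'](s)`,
`E = {d ↮ S ∪ Y}` (`d ∉ S`, `d ∉ O`, `s ≠ some d`, decoys of `L'` vertex slots `≠ d`). (transcription of the cell memo png-dp-vplus MEMO-gen12.md §4(b))
[cite: VandenbergHaggstromKahn2005, §2.1 Lemma 2.4 (p. 10); §1 display (10) (pp. 7–8) — corollaries] -/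
theorem decoy_world_term_set_merge (w : Sym2 V → ℝ) (hm : ∑ ω, weight w ω = 1) (x : V)
    (Y : Set V) (g : Set (Sym2 V) → ℝ) (O : Finset V) (S : Set V) {d : V} (hdS : d ∉ S) (hdO : d ∉ O)
    (L' : List (Option V × (Option V → ℝ))) (hL' : ∀ dc ∈ L', dc.1 ≠ some d)
    {s : Option V} (hs : s ≠ some d) (c : Option V → ℝ)
    (ℓ : Set (Sym2 V) → ℝ) (hℓ : ∀ ζ' : Set (Sym2 V), ℓ (setCl ζ' Y) = ind {β : Set (Sym2 V) | ∀ o ∈ O, β ∈ avoidEv o Y} ζ') :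
    ∑ ω, weight w ω * (ind (avoidEv x Y) ω *
        wcovOff w Y (fun β => g (openEdgeCluster β x))
          (fun ζ => av (openGraph ζ).Reachable S d * slForm L' (fun s' => chiO (openGraph ζ).Reachable O
            (ℓ (setCl ω Y)) S d s' - c s') s) ω) =
      ∑ ζ, weight w ζ * (resid w x Y g ζ * (ind (avoidEv d (S ∪ Y)) ζ *
        slForm L' (fun s' => ind (slotEv O d (S ∪ Y) s') ζ - c s') s)) := by
  classical
  set G : Set (Sym2 V) → ℝ := fun β => g (openEdgeCluster β x) with hG
  set ψ : Set (Sym2 V) → Set (Sym2 V) → ℝ := fun W ζ =>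
    av (openGraph ζ).Reachable S d * slForm L' (fun s' => chiO (openGraph ζ).Reachable O (ℓ W) S d s' - c s') s with hψ
  -- Step 1: Markov merge at `C_Y` (world-dependent test function)
  have step1 : ∑ ω, weight w ω * (ind (avoidEv x Y) ω * wcovOff w Y G (ψ (setCl ω Y)) ω) =
      ∑ ζ, weight w ζ * (resid w x Y g ζ * ψ (setCl ζ Y) (ζ \ cut Y ζ)) := by
    have h := MixCSH.markov_merge_Y₂ w hm x Y g ψ
    have lhs : ∀ ω, weight w ω * (ind (avoidEv x Y) ω * wcovOff w Y G (ψ (setCl ω Y)) ω) =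
        weight w ω * (ind (avoidEv x Y) ω * ∑ η, weight w η * ((g (openEdgeCluster (η \ cut Y ω) x) -
          wmeanOff w Y (fun β => g (openEdgeCluster β x)) ω) * ψ (setCl ω Y) (η \ cut Y ω))) := by
      intro ω; rw [wcovOff_eq_sum]
    rw [Finset.sum_congr rfl (fun ω _ => lhs ω), h]
    refine Finset.sum_congr rfl fun ζ _ => ?_
    unfold resid; ring
  -- Step 2: alive / dead
  have step2 : ∀ ζ, ψ (setCl ζ Y) (ζ \ cut Y ζ) =
      ind (avoidEv d (S ∪ Y)) ζ * slForm L' (fun s' => ind (slotEv O d (S ∪ Y) s') ζ - c s') s +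
        (1 - ind (avoidEv d Y) ζ) * (- slForm L' c s) := by
    intro ζ
    by_cases h : ζ ∈ avoidEv d Y
    · rw [hψ]
      dsimp only
      rw [world_term_alive_set h O S ℓ hℓ L' c s, ← ind_avoidEv_mul_union d S Y ζ, ind_of_mem h]; ring
    · rw [hψ]
      dsimp only
      rw [world_term_dead_set h hdO hdS (ℓ (setCl ζ Y)) L' hL' c hs, ind_of_not_mem h]
      have h0 : ind (avoidEv d (S ∪ Y)) ζ = 0 := ind_of_not_mem fun h' => h fun y hy => h' y (Or.inr hy)
      rw [h0]; ring
  -- Step 3: the dead part dies against the residual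
  have step3 : ∑ ζ, weight w ζ * (resid w x Y g ζ * ((1 - ind (avoidEv d Y) ζ) * (- slForm L' c s))) = 0 := by
    have h := residual_orthogonal w hm x Y g
      (fun W => (1 - (if (d ∈ Y ∨ ∃ e ∈ W, d ∈ e) then (0 : ℝ) else 1)) * (- slForm L' c s))
    rw [← h]
    refine Finset.sum_congr rfl fun ζ _ => ?_
    unfold resid
    rw [one_sub_ind_avoidEv_eq d Y ζ]; ring
  have e0 : ∀ ω, weight w ω * (ind (avoidEv x Y) ω * wcovOff w Y (fun β => g (openEdgeCluster β x))
      (fun ζ => av (openGraph ζ).Reachable S d * slForm L' (fun s' => chiO (openGraph ζ).Reachable O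
        (ℓ (setCl ω Y)) S d s' - c s') s) ω) =
      weight w ω * (ind (avoidEv x Y) ω * wcovOff w Y G (ψ (setCl ω Y)) ω) := fun ω => rfl
  rw [Finset.sum_congr rfl (fun ω _ => e0 ω), step1]
  have split : ∀ ζ, weight w ζ * (resid w x Y g ζ * ψ (setCl ζ Y) (ζ \ cut Y ζ)) =
      weight w ζ * (resid w x Y g ζ * (ind (avoidEv d (S ∪ Y)) ζ *
        slForm L' (fun s' => ind (slotEv O d (S ∪ Y) s') ζ - c s') s)) +
      weight w ζ * (resid w x Y g ζ * ((1 - ind (avoidEv d Y) ζ) * (- slForm L' c s))) := by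
    intro ζ; rw [step2 ζ]; ring
  rw [Finset.sum_congr rfl (fun ζ _ => split ζ), Finset.sum_add_distrib, step3, add_zero]

/-- **THE WORLD TERM OF ONE DECOY with a set observer, upper bound** (memo §4(b),(c); set version of `CSH.decoy_world_term`).  Data: owner `x`,
avoided set `Y`, source set `S ∋ x`, decoy `d ∉ S`, `d ∉ O`, later decoys `L'` (vertex slots, none equal to `d`), slot `s ≠ some d`,
`E = {d ↮ S ∪ Y}`, `m₀ = μ(E) ≠ 0`, `c(s') = μ(E ∩ slotEv s')/m₀`, liveness factor `ℓ(C_Y(ω))` on the set slot.  Then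
`Σ_ω w 1{x↮Y} Cov_{world(ω)}(g(C_x), ε(d)·sl_{L'}[chiO_d − c](s)) ≤ −m₀⁻¹ · sl_{L'}[s' ↦ m₀·P₁(s') − m₁(s')·P₀](s)`
(the coefficient of the set slot `sl_{L'}[δ_none](s) ∈ {0,1}` is `≥ 0` and its moment obeys the defect lemma `CSH.sum_resid_obs_le`; the vertex
slots are exact, `CSH.sum_resid_decoy_moment`). (transcription of the cell memo png-dp-vplus MEMO-gen12.md §4(b),(c))
[cite: VandenbergHaggstromKahn2005, §2.1 Lemma 2.4 (p. 10); §1 display (10) (pp. 7–8) — corollaries] -/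
theorem decoy_world_term_set_le (w : Sym2 V → ℝ) (hw0 : ∀ e, 0 ≤ w e) (hw1 : ∀ e, w e ≤ 1) (hm : ∑ ω, weight w ω = 1) (x : V)
    (Y : Set V) (g : Set (Sym2 V) → ℝ) (hg : Monotone g) (O : Finset V) {S : Set V} (hxS : x ∈ S) {d : V} (hdS : d ∉ S) (hdO : d ∉ O)
    (L' : List (Option V × (Option V → ℝ))) (hL : ∀ dc ∈ L', ∃ d', dc.1 = some d') (hL' : ∀ dc ∈ L', dc.1 ≠ some d)
    {s : Option V} (hs : s ≠ some d) (c : Option V → ℝ)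
    (ℓ : Set (Sym2 V) → ℝ) (hℓ : ∀ ζ' : Set (Sym2 V), ℓ (setCl ζ' Y) = ind {β : Set (Sym2 V) | ∀ o ∈ O, β ∈ avoidEv o Y} ζ')
    (hm₀ : ∑ ζ, weight w ζ * ind (avoidEv d (S ∪ Y)) ζ ≠ 0)
    (hc : ∀ s', c s' = (∑ ζ, weight w ζ * ind (avoidEv d (S ∪ Y) ∩ slotEv O d (S ∪ Y) s') ζ) /
      ∑ ζ, weight w ζ * ind (avoidEv d (S ∪ Y)) ζ) :
    ∑ ω, weight w ω * (ind (avoidEv x Y) ω *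
        wcovOff w Y (fun β => g (openEdgeCluster β x))
          (fun ζ => av (openGraph ζ).Reachable S d * slForm L' (fun s' => chiO (openGraph ζ).Reachable O
            (ℓ (setCl ω Y)) S d s' - c s') s) ω) ≤
      - ((∑ ζ, weight w ζ * ind (avoidEv d (S ∪ Y)) ζ)⁻¹ *
          slForm L' (fun s' =>
            (∑ ζ, weight w ζ * ind (avoidEv d (S ∪ Y)) ζ) *
                (∑ ζ, weight w ζ * (ind (avoidEv d (S ∪ Y) ∩ slotEv O d (S ∪ Y) s') ζ * phiS w x Y g d ζ)) -
              (∑ ζ, weight w ζ * ind (avoidEv d (S ∪ Y) ∩ slotEv O d (S ∪ Y) s') ζ) *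
                (∑ ζ, weight w ζ * (ind (avoidEv d (S ∪ Y)) ζ * phiS w x Y g d ζ))) s) := by
  classical
  have hA : insert x Y ⊆ S ∪ Y := by
    intro a ha
    rcases mem_insert_iff.1 ha with rfl | ha
    · exact Or.inl hxS
    · exact Or.inr ha
  rw [decoy_world_term_set_merge w hm x Y g O S hdS hdO L' hL' hs c ℓ hℓ]
  set m₀ := ∑ ζ, weight w ζ * ind (avoidEv d (S ∪ Y)) ζ with hm₀'
  set Q : Option V → ℝ := fun s' =>
    m₀ * (∑ ζ, weight w ζ * (ind (avoidEv d (S ∪ Y) ∩ slotEv O d (S ∪ Y) s') ζ * phiS w x Y g d ζ)) -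
      (∑ ζ, weight w ζ * ind (avoidEv d (S ∪ Y) ∩ slotEv O d (S ∪ Y) s') ζ) *
        (∑ ζ, weight w ζ * (ind (avoidEv d (S ∪ Y)) ζ * phiS w x Y g d ζ)) with hQ
  -- linearity of `sl_{L'}` over the slots
  have lin := fun ζ : Set (Sym2 V) => slForm_eq_sum_single L' (fun s' => ind (slotEv O d (S ∪ Y) s') ζ - c s') s
  simp only [lin, Finset.mul_sum]
  rw [Finset.sum_comm]
  have inner : ∀ (a : ℝ) (s' : Option V), ∑ ζ, weight w ζ * (resid w x Y g ζ * (ind (avoidEv d (S ∪ Y)) ζ *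
      (a * (ind (slotEv O d (S ∪ Y) s') ζ - c s')))) =
      a * ∑ ζ, weight w ζ * (resid w x Y g ζ * (ind (avoidEv d (S ∪ Y)) ζ * (ind (slotEv O d (S ∪ Y) s') ζ - c s'))) := by
    intro a s'
    rw [Finset.mul_sum]
    exact Finset.sum_congr rfl fun ζ _ => by ring
  simp only [inner]
  -- each slot: equality on vertex slots, the defect inequality on the set slot (coefficient `≥ 0`)
  have hbound : ∀ (s' : Option V) (a : ℝ), (s' = none → 0 ≤ a) →
      a * ∑ ζ, weight w ζ * (resid w x Y g ζ * (ind (avoidEv d (S ∪ Y)) ζ * (ind (slotEv O d (S ∪ Y) s') ζ - c s'))) ≤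
      a * (- (m₀⁻¹ * Q s')) := by
    intro s' a ha
    have hmom := sum_resid_slot_moment_le w hw0 hw1 hm x Y g hg O d hA s' hm₀ (hc s')
    cases s' with
    | none => exact mul_le_mul_of_nonneg_left hmom (ha rfl)
    | some w' =>
      have heq := sum_resid_decoy_moment w hm x Y g d hA w' hm₀ (by simpa only [slotEv_some] using hc (some w'))
      simp only [slotEv_some] at heq ⊢
      rw [heq]
      exact le_of_eq rfl
  refine (Finset.sum_le_sum fun s' _ => hbound s' _ fun hs' => ?_).trans ?_
  · subst hs'
    rw [slForm_single_none _ L' hL]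
    exact single_none_apply_nonneg _ s
  · rw [slForm_eq_sum_single L' Q s, Finset.mul_sum, ← Finset.sum_neg_distrib]
    exact le_of_eq (Finset.sum_congr rfl fun s' _ => by ring)

/-- **THE WORLD TERM OF ONE DECOY with a set observer, at a vertex slot** (exact, as `CSH.decoy_world_term`): for `s = some u`, `u ≠ d`, the
set slot has coefficient `0` in `sl_{L'}[·](some u)` and the identity of the point case holds:
`Σ_ω w 1{x↮Y} Cov_{world(ω)}(g(C_x), ε(d)·sl_{L'}[chiO_d − c](some u)) = −m₀⁻¹ · sl_{L'}[s' ↦ m₀·P₁(s') − m₁(s')·P₀](some u)`.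
(transcription of the cell memo png-dp-vplus MEMO-gen12.md §4(b))
[cite: VandenbergHaggstromKahn2005, §2.1 Lemma 2.4 (p. 10); §1 display (10) (pp. 7–8) — corollaries] -/
theorem decoy_world_term_set_some (w : Sym2 V → ℝ) (hm : ∑ ω, weight w ω = 1) (x : V)
    (Y : Set V) (g : Set (Sym2 V) → ℝ) (O : Finset V) {S : Set V} (hxS : x ∈ S) {d : V} (hdS : d ∉ S) (hdO : d ∉ O)
    (L' : List (Option V × (Option V → ℝ))) (hL : ∀ dc ∈ L', ∃ d', dc.1 = some d') (hL' : ∀ dc ∈ L', dc.1 ≠ some d)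
    {u : V} (hu : u ≠ d) (c : Option V → ℝ)
    (ℓ : Set (Sym2 V) → ℝ) (hℓ : ∀ ζ' : Set (Sym2 V), ℓ (setCl ζ' Y) = ind {β : Set (Sym2 V) | ∀ o ∈ O, β ∈ avoidEv o Y} ζ')
    (hm₀ : ∑ ζ, weight w ζ * ind (avoidEv d (S ∪ Y)) ζ ≠ 0)
    (hc : ∀ s', c s' = (∑ ζ, weight w ζ * ind (avoidEv d (S ∪ Y) ∩ slotEv O d (S ∪ Y) s') ζ) /
      ∑ ζ, weight w ζ * ind (avoidEv d (S ∪ Y)) ζ) :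
    ∑ ω, weight w ω * (ind (avoidEv x Y) ω *
        wcovOff w Y (fun β => g (openEdgeCluster β x))
          (fun ζ => av (openGraph ζ).Reachable S d * slForm L' (fun s' => chiO (openGraph ζ).Reachable O
            (ℓ (setCl ω Y)) S d s' - c s') (some u)) ω) =
      - ((∑ ζ, weight w ζ * ind (avoidEv d (S ∪ Y)) ζ)⁻¹ *
          slForm L' (fun s' =>
            (∑ ζ, weight w ζ * ind (avoidEv d (S ∪ Y)) ζ) *
                (∑ ζ, weight w ζ * (ind (avoidEv d (S ∪ Y) ∩ slotEv O d (S ∪ Y) s') ζ * phiS w x Y g d ζ)) -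
              (∑ ζ, weight w ζ * ind (avoidEv d (S ∪ Y) ∩ slotEv O d (S ∪ Y) s') ζ) *
                (∑ ζ, weight w ζ * (ind (avoidEv d (S ∪ Y)) ζ * phiS w x Y g d ζ))) (some u)) := by
  classical
  have hA : insert x Y ⊆ S ∪ Y := by
    intro a ha
    rcases mem_insert_iff.1 ha with rfl | ha
    · exact Or.inl hxS
    · exact Or.inr ha
  have hs : (some u : Option V) ≠ some d := fun h => hu (Option.some.inj h)
  rw [decoy_world_term_set_merge w hm x Y g O S hdS hdO L' hL' hs c ℓ hℓ]
  set m₀ := ∑ ζ, weight w ζ * ind (avoidEv d (S ∪ Y)) ζ with hm₀'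
  set Q : Option V → ℝ := fun s' =>
    m₀ * (∑ ζ, weight w ζ * (ind (avoidEv d (S ∪ Y) ∩ slotEv O d (S ∪ Y) s') ζ * phiS w x Y g d ζ)) -
      (∑ ζ, weight w ζ * ind (avoidEv d (S ∪ Y) ∩ slotEv O d (S ∪ Y) s') ζ) *
        (∑ ζ, weight w ζ * (ind (avoidEv d (S ∪ Y)) ζ * phiS w x Y g d ζ)) with hQ
  have lin := fun ζ : Set (Sym2 V) => slForm_eq_sum_single L' (fun s' => ind (slotEv O d (S ∪ Y) s') ζ - c s') (some u)
  simp only [lin, Finset.mul_sum]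
  rw [Finset.sum_comm]
  have inner : ∀ (a : ℝ) (s' : Option V), ∑ ζ, weight w ζ * (resid w x Y g ζ * (ind (avoidEv d (S ∪ Y)) ζ *
      (a * (ind (slotEv O d (S ∪ Y) s') ζ - c s')))) =
      a * ∑ ζ, weight w ζ * (resid w x Y g ζ * (ind (avoidEv d (S ∪ Y)) ζ * (ind (slotEv O d (S ∪ Y) s') ζ - c s'))) := by
    intro a s'
    rw [Finset.mul_sum]
    exact Finset.sum_congr rfl fun ζ _ => by ring
  simp only [inner]
  have hterm : ∀ (s' : Option V) (a : ℝ), (s' = none → a = 0) →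
      a * ∑ ζ, weight w ζ * (resid w x Y g ζ * (ind (avoidEv d (S ∪ Y)) ζ * (ind (slotEv O d (S ∪ Y) s') ζ - c s'))) =
      a * (- (m₀⁻¹ * Q s')) := by
    intro s' a ha
    cases s' with
    | none => rw [ha rfl, zero_mul, zero_mul]
    | some w' =>
      have heq := sum_resid_decoy_moment w hm x Y g d hA w' hm₀ (by simpa only [slotEv_some] using hc (some w'))
      simp only [slotEv_some] at heq ⊢
      rw [heq]
      rfl
  rw [Finset.sum_congr rfl (fun s' _ => hterm s' _ fun hs' => by subst hs'; rw [slForm_single_none _ L' hL]; exact single_none_apply_some _ u)]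
  rw [slForm_eq_sum_single L' Q (some u), Finset.mul_sum, ← Finset.sum_neg_distrib]
  exact Finset.sum_congr rfl fun s' _ => by ring

end CSHSet

end Summit.CriticalPhenomena.PercolationContinuityZ3.Theorems

end
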